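import Literature.Computability.Complexity.PPolyTuringClosure
import HarnessLib

/-!
# Functions whose bits have polynomial-size circuits: the bit graph is in `P/poly`, and `P^f ⊆ P/poly`

Trunk `CplxCore`, companion of `PPolyTuringClosure.lean`. For a function `f : {0,1}* → ℕ` we
package "the binary digits of `f` on inputs of length `m` are computed by `B₂`-circuits of size
`s(m)`, `s` a polynomial" as the structure `BitCircuits f` (a multi-output straight-line program,
`CktSize B2`, per input length; Arora–Barak 2009, Def. 6.1/6.5: "`FP/poly`") and prove

* `bitLang_mem_PPoly` — the bit graph `bitLang f = {⟨x, u⟩ | bit |u| of f x is 1}` is in `P/poly`;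
* `PRel_ofFun_subset_PPoly_of_bitCircuits` — hence `P^f ⊆ P/poly` (`PRel_ofFun_subset_PPoly`).

The first is NOT immediate from the definition of `P/poly` by circuit families, because a circuit
for the *paired* inputs `⟨x, u⟩` of a given total length would have to parse the pairing for every
split `|x|, |u|`; we go through Arora–Barak's `P/poly = P/poly-advice` (Thm. 6.18, proved in
`CircuitEval.lean`) instead: the advice for length `N` is the table of the descriptions
(`CircEval.desc`) of the single-bit circuits for all input lengths `m ≤ N` and bit positions
`i ≤ N`, and the `P` machine selects the right description by two list accesses
(`HashBricks.nthItemFn`) and evaluates it (`CircEval.evalFn ∈ FP`).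

The bit graph `bitLang f` (`PPolyTuringClosure.lean`) indexes bit positions in unary so that the
truth-table queries `⟨x, 1ⁱ⟩` of `ttFn` read them in order; the tree's `Oracle.bitLanguage`
(`AlgebrizationBarriers.lean`: binary index with a tag bit plus length queries, for a general
string oracle) is a different encoding serving relativization barriers and is not reused here.

## References

* S. Arora, B. Barak, *Computational Complexity: A Modern Approach*, CUP 2009, Def. 6.1, Def. 6.5,
  Def. 6.16, Thm. 6.18, §17.2.
-/

noncomputable section

namespace Literature.Computability.Complexity

open _root_.Computability Polynomial PRelSigma OracleCompose HashBricks Brick CircEval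

/-- **Polynomial-size circuits for the bits of `f`**: a bit-length bound `K` (`f x < 2^{K(|x|)}`),
a size bound `s`, and for every input length `m` one multi-output `B₂`-straight-line program of
size `≤ s(m)` computing the `K(m)` low bits of `f` on `{0,1}^m` ("`f ∈ FP/poly`": the class of
string functions computed by polynomial-size circuit families, Bürgisser, TCS 235 (2000), p. 75;
the function analogue of Arora–Barak's Def. 6.5). The number of outputs is a polynomial `K` in the
input length; a producer with an arbitrary p-bounded output count `t n ≤ K n` pads with constant
bits (as `exists_circuit` does past `K`) — that re-indexing constructor is not needed here and is
left to the first such consumer. [cite: Burgisser2000TCS, p. 75] -/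
structure BitCircuits (f : List Bool → ℕ) where
  /-- bit-length bound -/
  K : Polynomial ℕ
  /-- size bound -/
  s : Polynomial ℕ
  /-- `f x < 2^{K |x|}` -/
  lt : ∀ x : List Bool, f x < 2 ^ K.eval x.length
  /-- the circuits, one multi-output program per input length -/
  ckt : ∀ m : ℕ, CktSize B2 (fun (x : Fin m → Bool) (i : Fin (K.eval m)) => (f (List.ofFn x)).testBit i) (s.eval m)

namespace BitCircuits

variable {f : List Bool → ℕ} (B : BitCircuits f)

/-- **One circuit per bit**: for every input length `m` and bit position `i` a single-output
`B₂`-circuit of size `≤ s(m) + 1` computing bit `i` of `f` (an output wire of the program if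
`i < K(m)`, the constant `0` otherwise, as `f < 2^{K}`). [cite: AroraBarak2009, Rem. 6.4] -/
theorem exists_circuit (m i : ℕ) : ∃ C : Circuit (Fin m), C.IsOver B2 ∧ C.size ≤ B.s.eval m + 1 ∧
    ∀ x : Fin m → Bool, C.eval x = (f (List.ofFn x)).testBit i := by
  by_cases hi : i < B.K.eval m
  · obtain ⟨C, hC, hs, hev⟩ := ((B.ckt m).outMap fun _ : Unit => (⟨i, hi⟩ : Fin (B.K.eval m))).toCircuit
    exact ⟨C, hC, hs.trans (Nat.le_succ _), fun x => hev x⟩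
  · have h0 : ∀ x : Fin m → Bool, (f (List.ofFn x)).testBit i = false := fun x =>
      Nat.testBit_eq_false_of_lt ((B.lt _).trans_le (Nat.pow_le_pow_right (by norm_num)
        (by rw [List.length_ofFn]; omega)))
    obtain ⟨C, hC, hs, hev⟩ := ((cktSize_const (Fin m) false).congr
      (g := fun (x : Fin m → Bool) (_ : Unit) => (f (List.ofFn x)).testBit i) fun x _ => (h0 x).symm).toCircuit
    exact ⟨C, hC, hs.trans (by omega), fun x => hev x⟩

/-- The chosen circuit for bit `i` at input length `m`. [cite: AroraBarak2009, Rem. 6.4] -/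
def circ (m i : ℕ) : Circuit (Fin m) :=
  Classical.choose (B.exists_circuit m i)

/-- Its gates are binary. [folklore] -/
theorem circ_isOver (m i : ℕ) : (B.circ m i).IsOver B2 :=
  (Classical.choose_spec (B.exists_circuit m i)).1

/-- Its size. [folklore] -/
theorem size_circ_le (m i : ℕ) : (B.circ m i).size ≤ B.s.eval m + 1 :=
  (Classical.choose_spec (B.exists_circuit m i)).2.1

/-- Its value. [folklore] -/
theorem eval_circ (m i : ℕ) (x : Fin m → Bool) : (B.circ m i).eval x = (f (List.ofFn x)).testBit i :=
  (Classical.choose_spec (B.exists_circuit m i)).2.2 x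

/-- The row of the advice table for input length `m`: the descriptions of the bit circuits
`i = 0, …, N` (an instance of `PPolyTuring.table`). [cite: AroraBarak2009, Thm. 6.18] -/
def row (N m : ℕ) : List Bool :=
  PPolyTuring.table (fun i => desc (B.circ m i)) X N

/-- **The advice table for total length `N`**: the rows for `m = 0, …, N`. [cite: AroraBarak2009, Thm. 6.18] -/
def tab (N : ℕ) : List Bool :=
  PPolyTuring.table (B.row N) X N

/-- Reading the table: row `|x|`. [folklore] -/
theorem nthItemFn_tab {N : ℕ} {x : List Bool} (hx : x.length ≤ N) :
    nthItemFn (boolPair x (B.tab N)) = B.row N x.length :=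
  PPolyTuring.nthItemFn_table _ X N (by simpa using hx)

/-- Reading a row: the description of the circuit for bit `|u|`. [folklore] -/
theorem nthItemFn_row {N m : ℕ} {u : List Bool} (hu : u.length ≤ N) :
    nthItemFn (boolPair u (B.row N m)) = desc (B.circ m u.length) :=
  PPolyTuring.nthItemFn_table _ X N (by simpa using hu)

/-! ### Polynomial length of the table -/

/-- Length bound of a description at input length `m ≤ N`. [folklore] -/
def descPoly : Polynomial ℕ := (B.s + 2) * (8 * (X + B.s + 1) + 10)

/-- Length bound of a row. [folklore] -/
def rowPoly : Polynomial ℕ := (X + 1) * (2 * B.descPoly + 2)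

/-- Length bound of the table. [folklore] -/
def tabPoly : Polynomial ℕ := (X + 1) * (2 * B.rowPoly + 2)

/-- `|desc (circ m i)| ≤ descPoly N` for `m ≤ N`. [folklore] -/
theorem length_desc_circ_le {N m : ℕ} (hm : m ≤ N) (i : ℕ) : (desc (B.circ m i)).length ≤ B.descPoly.eval N := by
  refine (length_desc_le (B.circ m i)).trans ?_
  have hs : (B.circ m i).size ≤ B.s.eval N + 1 := (B.size_circ_le m i).trans (by
    have := TM2Iter.eval_mono B.s hm; omega)
  simp only [descPoly, eval_mul, eval_add, eval_ofNat, eval_X, eval_one]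
  exact Nat.mul_le_mul (by omega) (by omega)

/-- `|row N m| ≤ rowPoly N` for `m ≤ N`. [folklore] -/
theorem length_row_le {N m : ℕ} (hm : m ≤ N) : (B.row N m).length ≤ B.rowPoly.eval N := by
  have h := PPolyTuring.length_table_le (fun i => desc (B.circ m i)) X N (B.descPoly.eval N)
    fun i _ => B.length_desc_circ_le hm i
  simp only [rowPoly, eval_mul, eval_add, eval_ofNat, eval_X, eval_one] at h ⊢
  simpa [row] using h

/-- `|tab N| ≤ tabPoly N`. [folklore] -/
theorem length_tab_le (N : ℕ) : (B.tab N).length ≤ B.tabPoly.eval N := by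
  have h := PPolyTuring.length_table_le (B.row N) X N (B.rowPoly.eval N)
    fun m hm => B.length_row_le (by simpa using hm)
  simp only [tabPoly, eval_mul, eval_add, eval_ofNat, eval_X, eval_one] at h ⊢
  simpa [tab] using h

/-! ### The `P` language and the advice characterisation -/

/-- The selector `⟨z, T⟩ ↦ ⟨x, T[|x|][|u|]⟩` where `x, u` are the two components of `z`: the
input `x` paired with the description of the circuit for bit `|u|` at input length `|x|`. [cite: AroraBarak2009, Thm. 6.18] -/
def selFn : List Bool → List Bool :=
  pairFn (fstP ∘ fstP) (nthItemFn ∘ pairFn (sndP ∘ fstP) (nthItemFn ∘ pairFn (fstP ∘ fstP) sndP))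

/-- `selFn ∈ FP`. [cite: AroraBarak2009, Thm. 6.18] -/
theorem selFn_mem_FP : selFn ∈ FP :=
  pairFn_mem_FP (comp_mem_FP fstP_mem_FP fstP_mem_FP)
    (comp_mem_FP nthItemFn_mem_FP (pairFn_mem_FP (comp_mem_FP sndP_mem_FP fstP_mem_FP)
      (comp_mem_FP nthItemFn_mem_FP (pairFn_mem_FP (comp_mem_FP fstP_mem_FP fstP_mem_FP) sndP_mem_FP))))

/-- The value of the selector. [folklore] -/
theorem selFn_boolPair (z T : List Bool) :
    selFn (boolPair z T) = boolPair (fstP z) (nthItemFn (boolPair (sndP z) (nthItemFn (boolPair (fstP z) T)))) := by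
  simp [selFn, Function.comp_apply]

/-- The `P` language of the advice characterisation: "the selected circuit accepts the first
component". [cite: AroraBarak2009, Thm. 6.18] -/
def bitEvalLang : Language Bool := selFn ⁻¹' EvalLang

/-- `bitEvalLang ∈ P`. [cite: AroraBarak2009, Thm. 6.18] -/
theorem bitEvalLang_mem_P : bitEvalLang ∈ Classes.P := preimage_mem_P EvalLang_mem_P selFn_mem_FP

/-- **The bit graph with the table as advice**: for every string `z` (components `x, u`),
`z ∈ bitLang f ↔ ⟨z, tab |z|⟩ ∈ bitEvalLang`. [cite: AroraBarak2009, Thm. 6.18] -/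
theorem mem_bitLang_iff_tab (z : List Bool) : z ∈ bitLang f ↔ boolPair z (B.tab z.length) ∈ bitEvalLang := by
  have hparts := length_boolUnpair_parts_le z
  have hx : (fstP z).length ≤ z.length := by simp only [fstP]; omega
  have hu : (sndP z).length ≤ z.length := by simp only [sndP]; omega
  change (f (fstP z)).testBit (sndP z).length = true ↔ evalFn (selFn (boolPair z (B.tab z.length))) = [true]
  rw [selFn_boolPair, B.nthItemFn_tab hx, B.nthItemFn_row hu,
    evalFn_boolPair_desc (fstP z) (B.circ (fstP z).length (sndP z).length) (B.circ_isOver _ _),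
    B.eval_circ, List.ofFn_get, List.cons.injEq]
  simp

/-- **The bit graph of `f` is in `P/poly`** when the bits of `f` have polynomial-size circuits. [cite: AroraBarak2009, Def. 6.5 with Thm. 6.18] -/
theorem bitLang_mem_PPoly (B : BitCircuits f) : bitLang f ∈ PPoly :=
  polyAdvice_subset_PPoly P_subset_PPoly_holds
    ⟨bitEvalLang, bitEvalLang_mem_P, B.tab, B.tabPoly, B.length_tab_le, B.mem_bitLang_iff_tab⟩

/-- **`P^f ⊆ P/poly`** when the bits of `f` have polynomial-size circuits ("`f ∈ FP/poly`"):
the function oracle reduces to the bit graph (`PRel_ofFun_subset_PPoly`). [cite: AroraBarak2009, Thm. 6.18 with §17.2] -/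
theorem PRel_ofFun_subset_PPoly_of_bitCircuits (B : BitCircuits f) : PRel (Oracle.ofFun f) ⊆ PPoly :=
  PRel_ofFun_subset_PPoly B.K B.lt B.bitLang_mem_PPoly

end BitCircuits

end Literature.Computability.Complexity
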